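import Literature.Analysis.FluidPDE.NSWeakProductRule
import Literature.Analysis.FunctionSpaces.MollificationLp
import HarnessLib

/-!
# The weak product rule `∫ ⟪v, (v·∇)φ⟫ = -∫ ⟪(∇v) v, φ⟫` for Sobolev fields `v ∈ W^{1,2}(B)`

Analysis/FluidPDE theorem file (no new definitions), companion of `NSWeakProductRule.lean`.
That file identifies the distribution `-div (v ⊗ v)` with the function `-(v·∇)v = -(∇v) v` for a
**bounded** field `v ∈ L^∞(B)` with an integrable weak gradient on a ball `B ⊆ ℝ³`
(`setIntegral_inner_fderiv_apply_self_eq_neg`, Gilbarg–Trudinger 2001, §7.3, (7.18)). The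
weak–strong uniqueness argument for local Leray solutions (Lemarié-Rieusset 2016, Thm. 14.7,
file p. 515: the balance of `u₁·u₂` uses `u₂·div(u₁ ⊗ u₁) = u₂·((u₁·∇)u₁)` for slices
`u₁(t) ∈ H¹_loc`, which are not bounded) needs the same identity for **square-integrable**
fields with **square-integrable** weak gradient:

* `setIntegral_inner_fderiv_apply_self_eq_neg_of_sq` — for `v ∈ L²(B)` with a weak gradient
  `g ∈ L²(B)` on the ball `B` (`HasWeakFDerivOn`) whose trace vanishes a.e. (`v` weakly
  divergence free) and a test field `φ ∈ C_c^∞(B; ℝ³)`,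
  `∫_B ⟪v, Dφ(v)⟫ = -∫_B ⟪g v, φ⟫`.

Proof: as in the bounded case, mollify the zero extension `𝟙_B v` into smooth fields `wₙ`,
divergence free on `supp φ` for large `n` (`traceCoord_fderiv_mollified_eq_zero`), and test the
weak derivative of `v` with `(wₙ)ⱼ φᵢ` (`integrableOn_and_setIntegral_productRule`):
`∫ (⟪v, Dφ(wₙ)⟫ + ⟪g wₙ, φ⟫) = 0`; the limit `n → ∞` is now taken in `L²`
(`FunctionSpaces.tendsto_eLpNorm_normed_convolution_sub_self`: `wₙ → 𝟙_B v` in `L²(ℝ³)`) through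
the Cauchy–Schwarz bound `|∫ (⟪v, Dφ(wₙ - v)⟫ + ⟪g (wₙ - v), φ⟫)| ≤ C (‖v‖₂ + ‖g‖₂) ‖wₙ - 𝟙_B v‖₂`
(Evans 2010, §5.2.3 Thm. 1 (iv) with §5.3; Gilbarg–Trudinger (7.18)).

## Mathlib / tree search

Tree: `integrableOn_and_setIntegral_productRule`, `traceCoord_fderiv_mollified_eq_zero`,
`aestronglyMeasurable_clm_apply_fin3` (`NSWeakProductRule`); `exists_contDiffBump_seq`,
`memLp_normed_convolution`, `tendsto_eLpNorm_normed_convolution_sub_self`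
(`FunctionSpaces/Mollification`, `MollificationLp`); `SerrinBoundedHolder.traceCoord`. Mathlib:
`ENNReal.lintegral_mul_le_Lp_mul_Lq`, `memLp_indicator_iff_restrict`,
`eLpNorm_eq_lintegral_rpow_enorm`, `memLp_two_iff_integrable_sq_norm`.

## References

* D. Gilbarg, N. S. Trudinger, *Elliptic partial differential equations of second order* (2001),
  §7.3, (7.18). [GilbargTrudinger2001]
* L. C. Evans, *Partial Differential Equations* (2010), §5.2.3 Thm. 1, §5.3. [Evans2010]
* P. G. Lemarié-Rieusset, *The Navier–Stokes Problem in the 21st Century* (2016), Thm. 14.7,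
  proof, p. 515. [LemarieRieusset2016]
-/

noncomputable section

open MeasureTheory TopologicalSpace Set Function Metric Filter
open scoped Laplacian InnerProductSpace RealInnerProductSpace ENNReal NNReal Topology

namespace Literature.Analysis.FluidPDE

section ConvSliceSq

open FunctionSpaces SerrinBoundedHolder
open scoped Convolution

/-- **Cauchy–Schwarz for a product of norms, real form with `ℝ≥0∞` data.** If `f` and `d` are
a.e.-strongly measurable with `∫⁻ ‖f‖ₑ², ∫⁻ ‖d‖ₑ² < ∞` for a measure `μ`, then
`∫ ‖f‖‖d‖ dμ ≤ ((∫⁻ ‖f‖ₑ²)^{1/2} (∫⁻ ‖d‖ₑ²)^{1/2}).toReal`. [folklore] -/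
theorem integral_norm_mul_norm_le_toReal {α X Y : Type*} [MeasurableSpace α] {μ : Measure α}
    [NormedAddCommGroup X] [NormedAddCommGroup Y] {f : α → X} {d : α → Y}
    (hf : AEStronglyMeasurable f μ) (hd : AEStronglyMeasurable d μ)
    (hf2 : ∫⁻ x, ‖f x‖ₑ ^ 2 ∂μ ≠ ∞) (hd2 : ∫⁻ x, ‖d x‖ₑ ^ 2 ∂μ ≠ ∞) :
    ∫ x, ‖f x‖ * ‖d x‖ ∂μ ≤
      ((∫⁻ x, ‖f x‖ₑ ^ 2 ∂μ) ^ (1 / 2 : ℝ) * (∫⁻ x, ‖d x‖ₑ ^ 2 ∂μ) ^ (1 / 2 : ℝ)).toReal := by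
  have hpq : (2 : ℝ).HolderConjugate 2 := Real.HolderConjugate.two_two
  have hH := ENNReal.lintegral_mul_le_Lp_mul_Lq μ hpq hf.enorm hd.enorm
  have e2 : ∀ (h : α → ℝ≥0∞), ∫⁻ x, h x ^ (2 : ℝ) ∂μ = ∫⁻ x, h x ^ 2 ∂μ :=
    fun h => lintegral_congr fun x => by
      rw [show (2 : ℝ) = ((2 : ℕ) : ℝ) by norm_num, ENNReal.rpow_natCast]
  rw [e2, e2] at hH
  simp only [Pi.mul_apply] at hH
  have hm : AEStronglyMeasurable (fun x => ‖f x‖ * ‖d x‖) μ := hf.norm.mul hd.norm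
  rw [integral_eq_lintegral_of_nonneg_ae (Eventually.of_forall fun x => by positivity) hm]
  have e3 : ∫⁻ x, ENNReal.ofReal (‖f x‖ * ‖d x‖) ∂μ = ∫⁻ x, ‖f x‖ₑ * ‖d x‖ₑ ∂μ :=
    lintegral_congr fun x => by
      rw [ENNReal.ofReal_mul (norm_nonneg _), ofReal_norm, ofReal_norm]
  rw [e3]
  refine ENNReal.toReal_mono ?_ hH
  exact ENNReal.mul_ne_top (ENNReal.rpow_ne_top_of_nonneg (by norm_num) hf2)
    (ENNReal.rpow_ne_top_of_nonneg (by norm_num) hd2)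

/-- `‖f‖‖d‖` is integrable when `‖f‖², ‖d‖²` are (`2‖f‖‖d‖ ≤ ‖f‖² + ‖d‖²`). [folklore] -/
theorem integrable_norm_mul_norm_of_sq {α X Y : Type*} [MeasurableSpace α] {μ : Measure α}
    [NormedAddCommGroup X] [NormedAddCommGroup Y] {f : α → X} {d : α → Y}
    (hf : AEStronglyMeasurable f μ) (hd : AEStronglyMeasurable d μ)
    (hf2 : Integrable (fun x => ‖f x‖ ^ 2) μ) (hd2 : Integrable (fun x => ‖d x‖ ^ 2) μ) :
    Integrable (fun x => ‖f x‖ * ‖d x‖) μ := by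
  refine Integrable.mono' ((hf2.add hd2).div_const 2) (hf.norm.mul hd.norm)
    (Eventually.of_forall fun x => ?_)
  rw [Real.norm_eq_abs, abs_of_nonneg (by positivity)]
  have h := two_mul_le_add_sq ‖f x‖ ‖d x‖
  simp only [Pi.add_apply]
  linarith

variable {x₀ : EuclideanSpace ℝ (Fin 3)} {ρ : ℝ} {v : EuclideanSpace ℝ (Fin 3) → EuclideanSpace ℝ (Fin 3)}
  {g : EuclideanSpace ℝ (Fin 3) → EuclideanSpace ℝ (Fin 3) →L[ℝ] EuclideanSpace ℝ (Fin 3)}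

/-- **`∫ ⟪v, (v·∇)φ⟫ = -∫ ⟪(∇v) v, φ⟫` for a square-integrable, weakly differentiable, weakly
divergence-free field with square-integrable weak gradient on a ball** (the identification of
the distribution `-div (v ⊗ v)` with the function `-(v·∇)v = -(∇v) v` for `v ∈ W^{1,2}(B)`;
Gilbarg–Trudinger (7.18)-type product rule; Evans 2010, §5.2.3 Thm. 1 (iv)). Hypotheses:
`v ∈ L²(B)` with weak gradient `g ∈ L²(B)` on the ball `B = B(x₀, ρ)` (`HasWeakFDerivOn`),
`tr g = 0` a.e. on `B`, `φ ∈ C_c^∞(B; ℝ³)`. Proof: module docstring (mollification and an `L²`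
limit). This is the slice-wise form of `u·div(u ⊗ u) = u·((u·∇)u)` used for `H¹_loc` slices in
Lemarié-Rieusset 2016, proof of Thm. 14.7, p. 515. [cite: GilbargTrudinger2001, §7.3 (7.18); Evans2010 §5.2.3 Thm. 1 (iv)] -/
theorem setIntegral_inner_fderiv_apply_self_eq_neg_of_sq
    (hv : HasWeakFDerivOn (⟨ball x₀ ρ, isOpen_ball⟩ : Opens (EuclideanSpace ℝ (Fin 3))) volume v g)
    (hv2 : ∫⁻ x in ball x₀ ρ, ‖v x‖ₑ ^ 2 < ∞) (hg2 : ∫⁻ x in ball x₀ ρ, ‖g x‖ₑ ^ 2 < ∞)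
    (htr : ∀ᵐ x ∂(volume.restrict (ball x₀ ρ)), ∑ j, g x (EuclideanSpace.single j (1 : ℝ)) j = 0)
    {φ : EuclideanSpace ℝ (Fin 3) → EuclideanSpace ℝ (Fin 3)}
    (hφ : IsTestFunctionOn (⟨ball x₀ ρ, isOpen_ball⟩ : Opens (EuclideanSpace ℝ (Fin 3))) φ) :
    ∫ x in ball x₀ ρ, ⟪v x, fderiv ℝ φ x (v x)⟫ = -∫ x in ball x₀ ρ, ⟪g x (v x), φ x⟫ := by
  set B : Set (EuclideanSpace ℝ (Fin 3)) := ball x₀ ρ with hB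
  have hBm : MeasurableSet B := measurableSet_ball
  haveI : IsFiniteMeasure (volume.restrict B) :=
    ⟨by rw [Measure.restrict_apply_univ]; exact measure_ball_lt_top⟩
  -- measurability, `L²` and `L¹` on `B`
  have hvm : AEStronglyMeasurable v (volume.restrict B) :=
    hv.locallyIntegrableOn.aestronglyMeasurable
  have hgm : AEStronglyMeasurable g (volume.restrict B) :=
    hv.locallyIntegrableOn_deriv.aestronglyMeasurable
  have hvL2 : MemLp v 2 (volume.restrict B) := by
    refine ⟨hvm, ?_⟩
    rw [eLpNorm_lt_top_iff_lintegral_rpow_enorm_lt_top two_ne_zero ENNReal.ofNat_ne_top]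
    simp only [ENNReal.toReal_ofNat, ENNReal.rpow_ofNat]
    exact hv2
  have hgL2 : MemLp g 2 (volume.restrict B) := by
    refine ⟨hgm, ?_⟩
    rw [eLpNorm_lt_top_iff_lintegral_rpow_enorm_lt_top two_ne_zero ENNReal.ofNat_ne_top]
    simp only [ENNReal.toReal_ofNat, ENNReal.rpow_ofNat]
    exact hg2
  have hvI : IntegrableOn v B volume := hvL2.integrable one_le_two
  have hgI : IntegrableOn g B volume := hgL2.integrable one_le_two
  have hv2I : IntegrableOn (fun x => ‖v x‖ ^ 2) B volume := (memLp_two_iff_integrable_sq_norm hvm).1 hvL2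
  have hg2I : IntegrableOn (fun x => ‖g x‖ ^ 2) B volume := (memLp_two_iff_integrable_sq_norm hgm).1 hgL2
  -- the zero extension and its mollifications
  set vt : EuclideanSpace ℝ (Fin 3) → EuclideanSpace ℝ (Fin 3) := B.indicator v with hvt
  have hvt2 : MemLp vt 2 volume := (memLp_indicator_iff_restrict hBm).2 hvL2
  have hvtI : Integrable vt volume := hvI.integrable_indicator hBm
  have hvtli : LocallyIntegrable vt volume := hvtI.locallyIntegrable
  obtain ⟨bump, hbr, hratio⟩ := exists_contDiffBump_seq (E := EuclideanSpace ℝ (Fin 3))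
  set w : ℕ → EuclideanSpace ℝ (Fin 3) → EuclideanSpace ℝ (Fin 3) := fun n =>
    (bump n).normed volume ⋆[ContinuousLinearMap.lsmul ℝ ℝ, volume] vt with hw
  have hw_smooth : ∀ n, ContDiff ℝ (⊤ : ℕ∞) (w n) := fun n =>
    (bump n).hasCompactSupport_normed.contDiff_convolution_left _ (bump n).contDiff_normed hvtli
  have hw_cont : ∀ n, Continuous (w n) := fun n => (hw_smooth n).continuous
  have hwL2 : ∀ n, MemLp (w n) 2 volume := fun n => memLp_normed_convolution (bump n) hvt2 one_le_two
  -- `L²` convergence `wₙ → 𝟙_B v`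
  have hL2 : Tendsto (fun n => eLpNorm (w n - vt) 2 volume) atTop (𝓝 0) :=
    tendsto_eLpNorm_normed_convolution_sub_self hbr one_le_two ENNReal.ofNat_ne_top hvt2
  -- room between `supp φ` and the boundary of the ball
  obtain ⟨δ, hδ, hδB⟩ :=
    hφ.hasCompactSupport.exists_cthickening_subset_open isOpen_ball hφ.tsupport_subset
  have hN : ∀ᶠ n in atTop, (bump n).rOut < δ := hbr (gt_mem_nhds hδ)
  -- the identities for large `n`
  have hstage : ∀ᶠ n in atTop,
      ∫ x in B, (⟪v x, fderiv ℝ φ x (w n x)⟫ + ⟪g x (w n x), φ x⟫) = 0 := by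
    filter_upwards [hN] with n hn
    have key := (integrableOn_and_setIntegral_productRule hv (hw_smooth n) hφ).2
    have htr0 : ∀ x, traceCoord (fderiv ℝ (w n) x) * ⟪v x, φ x⟫ = 0 := by
      intro x
      by_cases hx : x ∈ tsupport φ
      · have hsub : closedBall x (bump n).rOut ⊆ B :=
          (closedBall_subset_cthickening hx _).trans ((cthickening_mono hn.le _).trans hδB)
        rw [traceCoord_fderiv_mollified_eq_zero hv hvI hgI htr (bump n) hsub, zero_mul]
      · rw [image_eq_zero_of_notMem_tsupport hx, inner_zero_right, mul_zero]
    have heq : (fun x => ⟪v x, fderiv ℝ φ x (w n x)⟫ +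
        traceCoord (fderiv ℝ (w n) x) * ⟪v x, φ x⟫ + ⟪g x (w n x), φ x⟫) =
        fun x => ⟪v x, fderiv ℝ φ x (w n x)⟫ + ⟪g x (w n x), φ x⟫ := by
      funext x
      rw [htr0 x, add_zero]
    rwa [heq] at key
  clear_value w
  -- bounds for the test field
  obtain ⟨Cφ, hCφ⟩ := hφ.contDiff.continuous.bounded_above_of_compact_support hφ.hasCompactSupport
  have hDφc : Continuous (fderiv ℝ φ) := hφ.contDiff.continuous_fderiv (by simp)
  obtain ⟨CD, hCD⟩ := hDφc.bounded_above_of_compact_support (hφ.hasCompactSupport.fderiv ℝ)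
  have hCφ0 : 0 ≤ Cφ := (norm_nonneg _).trans (hCφ 0)
  have hCD0 : 0 ≤ CD := (norm_nonneg _).trans (hCD 0)
  -- the integrand as a function of the field plugged in
  set F : (EuclideanSpace ℝ (Fin 3) → EuclideanSpace ℝ (Fin 3)) → EuclideanSpace ℝ (Fin 3) → ℝ :=
    fun u x => ⟪v x, fderiv ℝ φ x (u x)⟫ + ⟪g x (u x), φ x⟫ with hF
  have hFpt : ∀ (u : EuclideanSpace ℝ (Fin 3) → EuclideanSpace ℝ (Fin 3)) x,
      ‖F u x‖ ≤ CD * (‖v x‖ * ‖u x‖) + Cφ * (‖g x‖ * ‖u x‖) := by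
    intro u x
    calc ‖F u x‖ ≤ ‖⟪v x, fderiv ℝ φ x (u x)⟫‖ + ‖⟪g x (u x), φ x⟫‖ := norm_add_le _ _
      _ ≤ ‖v x‖ * ‖fderiv ℝ φ x (u x)‖ + ‖g x (u x)‖ * ‖φ x‖ :=
          add_le_add (norm_inner_le_norm _ _) (norm_inner_le_norm _ _)
      _ ≤ ‖v x‖ * (CD * ‖u x‖) + (‖g x‖ * ‖u x‖) * Cφ := by
          gcongr
          · exact (ContinuousLinearMap.le_opNorm _ _).trans
              (mul_le_mul_of_nonneg_right (hCD x) (norm_nonneg _))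
          · exact ContinuousLinearMap.le_opNorm _ _
          · exact hCφ x
      _ = CD * (‖v x‖ * ‖u x‖) + Cφ * (‖g x‖ * ‖u x‖) := by ring
  have hFm : ∀ {u : EuclideanSpace ℝ (Fin 3) → EuclideanSpace ℝ (Fin 3)},
      AEStronglyMeasurable u (volume.restrict B) → AEStronglyMeasurable (F u) (volume.restrict B) :=
    fun hum => (hvm.inner (aestronglyMeasurable_clm_apply_fin3 hDφc.aestronglyMeasurable hum)).add
      ((aestronglyMeasurable_clm_apply_fin3 hgm hum).inner hφ.contDiff.continuous.aestronglyMeasurable)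
  have hFint : ∀ {u : EuclideanSpace ℝ (Fin 3) → EuclideanSpace ℝ (Fin 3)},
      AEStronglyMeasurable u (volume.restrict B) → IntegrableOn (fun x => ‖u x‖ ^ 2) B volume →
      IntegrableOn (F u) B volume := by
    intro u hum hu2
    refine Integrable.mono' (((integrable_norm_mul_norm_of_sq hvm hum hv2I hu2).const_mul CD).add
      ((integrable_norm_mul_norm_of_sq hgm hum hg2I hu2).const_mul Cφ)) (hFm hum)
      (Eventually.of_forall fun x => hFpt u x)
  -- the difference `F (wₙ) - F v = F (wₙ - v)` and its `L²` bound
  have hwm : ∀ n, AEStronglyMeasurable (w n) (volume.restrict B) := fun n =>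
    (hw_cont n).aestronglyMeasurable
  have hw2I : ∀ n, IntegrableOn (fun x => ‖w n x‖ ^ 2) B volume := fun n =>
    ((memLp_two_iff_integrable_sq_norm (hwL2 n).1).1 (hwL2 n)).integrableOn
  have hdm : ∀ n, AEStronglyMeasurable (fun x => w n x - v x) (volume.restrict B) := fun n =>
    (hwm n).sub hvm
  have hd2I : ∀ n, IntegrableOn (fun x => ‖w n x - v x‖ ^ 2) B volume := by
    intro n
    have h := (hwL2 n).restrict B |>.sub hvL2
    exact (memLp_two_iff_integrable_sq_norm (hdm n)).1 h
  have hlin : ∀ n x, F (w n) x - F v x = F (fun y => w n y - v y) x := by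
    intro n x
    simp only [hF, map_sub, inner_sub_right, inner_sub_left]
    ring
  -- `L²` quantities
  set Av : ℝ≥0∞ := ∫⁻ x in B, ‖v x‖ₑ ^ 2 with hAv
  set Ag : ℝ≥0∞ := ∫⁻ x in B, ‖g x‖ₑ ^ 2 with hAg
  have hDle : ∀ n, ∫⁻ x in B, ‖w n x - v x‖ₑ ^ 2 ≤ eLpNorm (w n - vt) 2 volume ^ 2 := by
    intro n
    have e1 : ∫⁻ x in B, ‖w n x - v x‖ₑ ^ 2 = ∫⁻ x in B, ‖(w n - vt) x‖ₑ ^ 2 := by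
      refine setLIntegral_congr_fun hBm fun x hx => ?_
      simp only [Pi.sub_apply, hvt, indicator_of_mem hx]
    have key : eLpNorm (w n - vt) 2 volume ^ 2 = ∫⁻ x, ‖(w n - vt) x‖ₑ ^ 2 := by
      rw [eLpNorm_eq_lintegral_rpow_enorm_toReal two_ne_zero ENNReal.ofNat_ne_top, ENNReal.toReal_ofNat,
        ← ENNReal.rpow_two, ← ENNReal.rpow_mul]
      norm_num
    rw [e1, key]
    exact lintegral_mono' Measure.restrict_le_self le_rfl
  have hEtop : ∀ n, eLpNorm (w n - vt) 2 volume ≠ ∞ := fun n => ((hwL2 n).sub hvt2).eLpNorm_ne_top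
  -- the real bound of the difference of the integrals
  set bnd : ℕ → ℝ := fun n => (CD * (Av ^ (1 / 2 : ℝ)).toReal + Cφ * (Ag ^ (1 / 2 : ℝ)).toReal) *
    (eLpNorm (w n - vt) 2 volume).toReal with hbnd
  have hbound : ∀ n, ‖(∫ x in B, F (w n) x) - ∫ x in B, F v x‖ ≤ bnd n := by
    intro n
    have hD2 : ∫⁻ x in B, ‖w n x - v x‖ₑ ^ 2 ≠ ∞ :=
      ne_top_of_le_ne_top (ENNReal.pow_ne_top (hEtop n)) (hDle n)
    have hDhalf : ((∫⁻ x in B, ‖w n x - v x‖ₑ ^ 2) ^ (1 / 2 : ℝ)).toReal ≤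
        (eLpNorm (w n - vt) 2 volume).toReal := by
      refine ENNReal.toReal_mono (hEtop n) ?_
      calc (∫⁻ x in B, ‖w n x - v x‖ₑ ^ 2) ^ (1 / 2 : ℝ)
          ≤ (eLpNorm (w n - vt) 2 volume ^ 2) ^ (1 / 2 : ℝ) := ENNReal.rpow_le_rpow (hDle n) (by norm_num)
        _ = eLpNorm (w n - vt) 2 volume := by
            rw [← ENNReal.rpow_two, ← ENNReal.rpow_mul]; norm_num
    rw [← integral_sub (hFint (hwm n) (hw2I n)) (hFint hvm hv2I)]
    calc ‖∫ x in B, (F (w n) x - F v x)‖ ≤ ∫ x in B, ‖F (w n) x - F v x‖ := norm_integral_le_integral_norm _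
      _ ≤ ∫ x in B, (CD * (‖v x‖ * ‖w n x - v x‖) + Cφ * (‖g x‖ * ‖w n x - v x‖)) := by
          refine integral_mono_of_nonneg (Eventually.of_forall fun x => norm_nonneg _)
            (((integrable_norm_mul_norm_of_sq hvm (hdm n) hv2I (hd2I n)).const_mul CD).add
              ((integrable_norm_mul_norm_of_sq hgm (hdm n) hg2I (hd2I n)).const_mul Cφ))
            (Eventually.of_forall fun x => ?_)
          dsimp only
          rw [hlin n x]
          exact hFpt (fun y => w n y - v y) x
      _ = CD * (∫ x in B, ‖v x‖ * ‖w n x - v x‖) + Cφ * (∫ x in B, ‖g x‖ * ‖w n x - v x‖) := by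
          rw [integral_add ((integrable_norm_mul_norm_of_sq hvm (hdm n) hv2I (hd2I n)).const_mul CD)
            ((integrable_norm_mul_norm_of_sq hgm (hdm n) hg2I (hd2I n)).const_mul Cφ),
            integral_const_mul, integral_const_mul]
      _ ≤ CD * ((Av ^ (1 / 2 : ℝ)).toReal * (eLpNorm (w n - vt) 2 volume).toReal) +
            Cφ * ((Ag ^ (1 / 2 : ℝ)).toReal * (eLpNorm (w n - vt) 2 volume).toReal) := by
          gcongr
          · calc ∫ x in B, ‖v x‖ * ‖w n x - v x‖
                ≤ ((Av ^ (1 / 2 : ℝ)) * (∫⁻ x in B, ‖w n x - v x‖ₑ ^ 2) ^ (1 / 2 : ℝ)).toReal :=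
                  integral_norm_mul_norm_le_toReal hvm (hdm n) hv2.ne hD2
              _ = (Av ^ (1 / 2 : ℝ)).toReal * ((∫⁻ x in B, ‖w n x - v x‖ₑ ^ 2) ^ (1 / 2 : ℝ)).toReal :=
                  ENNReal.toReal_mul
              _ ≤ (Av ^ (1 / 2 : ℝ)).toReal * (eLpNorm (w n - vt) 2 volume).toReal :=
                  mul_le_mul_of_nonneg_left hDhalf ENNReal.toReal_nonneg
          · calc ∫ x in B, ‖g x‖ * ‖w n x - v x‖
                ≤ ((Ag ^ (1 / 2 : ℝ)) * (∫⁻ x in B, ‖w n x - v x‖ₑ ^ 2) ^ (1 / 2 : ℝ)).toReal :=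
                  integral_norm_mul_norm_le_toReal hgm (hdm n) hg2.ne hD2
              _ = (Ag ^ (1 / 2 : ℝ)).toReal * ((∫⁻ x in B, ‖w n x - v x‖ₑ ^ 2) ^ (1 / 2 : ℝ)).toReal :=
                  ENNReal.toReal_mul
              _ ≤ (Ag ^ (1 / 2 : ℝ)).toReal * (eLpNorm (w n - vt) 2 volume).toReal :=
                  mul_le_mul_of_nonneg_left hDhalf ENNReal.toReal_nonneg
      _ = bnd n := by simp only [hbnd]; ring
  -- the bound tends to zero, hence the integrals converge
  have hbnd0 : Tendsto bnd atTop (𝓝 0) := by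
    have h1 : Tendsto (fun n => (eLpNorm (w n - vt) 2 volume).toReal) atTop (𝓝 0) := by
      have := (ENNReal.tendsto_toReal ENNReal.zero_ne_top).comp hL2
      rw [ENNReal.toReal_zero] at this
      exact this
    have := h1.const_mul (CD * (Av ^ (1 / 2 : ℝ)).toReal + Cφ * (Ag ^ (1 / 2 : ℝ)).toReal)
    rw [mul_zero] at this
    exact this
  have hlim : Tendsto (fun n => ∫ x in B, F (w n) x) atTop (𝓝 (∫ x in B, F v x)) := by
    rw [tendsto_iff_norm_sub_tendsto_zero]
    exact squeeze_zero (fun n => norm_nonneg _) hbound hbnd0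
  have hzero : ∫ x in B, F v x = 0 := by
    refine tendsto_nhds_unique hlim ?_
    exact tendsto_const_nhds.congr' (hstage.mono fun n hn => hn.symm)
  -- split the integral
  have hI1 : IntegrableOn (fun x => ⟪v x, fderiv ℝ φ x (v x)⟫) B volume := by
    refine Integrable.mono' ((integrable_norm_mul_norm_of_sq hvm hvm hv2I hv2I).const_mul CD)
      (hvm.inner (aestronglyMeasurable_clm_apply_fin3 hDφc.aestronglyMeasurable hvm))
      (Eventually.of_forall fun x => ?_)
    calc ‖⟪v x, fderiv ℝ φ x (v x)⟫‖ ≤ ‖v x‖ * ‖fderiv ℝ φ x (v x)‖ := norm_inner_le_norm _ _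
      _ ≤ ‖v x‖ * (CD * ‖v x‖) := by
          gcongr
          exact (ContinuousLinearMap.le_opNorm _ _).trans
            (mul_le_mul_of_nonneg_right (hCD x) (norm_nonneg _))
      _ = CD * (‖v x‖ * ‖v x‖) := by ring
  have hI2 : IntegrableOn (fun x => ⟪g x (v x), φ x⟫) B volume := by
    refine Integrable.mono' ((integrable_norm_mul_norm_of_sq hgm hvm hg2I hv2I).const_mul Cφ)
      ((aestronglyMeasurable_clm_apply_fin3 hgm hvm).inner hφ.contDiff.continuous.aestronglyMeasurable)
      (Eventually.of_forall fun x => ?_)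
    calc ‖⟪g x (v x), φ x⟫‖ ≤ ‖g x (v x)‖ * ‖φ x‖ := norm_inner_le_norm _ _
      _ ≤ (‖g x‖ * ‖v x‖) * Cφ := by
          gcongr
          · exact ContinuousLinearMap.le_opNorm _ _
          · exact hCφ x
      _ = Cφ * (‖g x‖ * ‖v x‖) := by ring
  have hsum : ∫ x in B, F v x = (∫ x in B, ⟪v x, fderiv ℝ φ x (v x)⟫) + ∫ x in B, ⟪g x (v x), φ x⟫ := by
    simp only [hF]
    exact integral_add hI1 hI2
  rw [hsum] at hzero
  linarith

end ConvSliceSq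

end Literature.Analysis.FluidPDE
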